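import Mathlib
import Literature.Barriers.ValiantsHypothesis.AlgebraicNaturalProofs
import Literature.Computability.AlgebraicComplexity.ArithCircuitProofs
import Summits.ValiantsHypothesis.ValiantsHypothesis.Theorems.BarrierLeverPartitionMinorsHitByVPStratifiedLayouts
import Summits.ValiantsHypothesis.ValiantsHypothesis.Theses.BarrierLever

/-!
# Route BarrierLever — item `PartitionMinorsHitByVP` (stmt-ValiantsHypothesis-19717):
# the strata door with GENERAL leaves, and unions of HAMMING SPHERES around two centres

Helper file (`--supports stmt-ValiantsHypothesis-19717`; cell valiant-natproofs, rung V4, 𝒟-side,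
prover seat val-np-p6 gen 0). Definition-free. Closes NO item.

* **`partitionMinorsHitByVP_of_strataHit`** — the leaf-agnostic conditional door: if, eventually in
  `h`, every injective layout has a stratification (one threshold pair, `m ≤ (h+h)^c` strata, any
  injective matching realised by a permutation `e`) every stratum of which is hit by SOME polynomial
  in `SmallCircuits ℂ (h+h) c'`, then item 19717 holds verbatim with `b = c + c' + 3`. Any future
  leaf theorem (product states, automorphic cells, spheres, …) plugs into this statement; the
  taxonomy-specific `…StrataDoor.partitionMinorsHitByVP_of_strataLeaves` (p449543) is an instance.
* `sum_sign_eq_card_symmDiff` — `Σ_{a ∈ S} (a ∈ z ? −1 : 1) = #(S ∆ z) − #z`: the Hamming distance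
  to a centre `z` is an affine threshold functional (`λ_a = ∓1`), so spheres around `z` are strata.
* **`partitionMinor_hit_of_sphereClasses`** (UNCONDITIONAL CLASS) — rows = ALL sets at Hamming
  distance `∈ A` from a centre `z₁`, columns = ALL sets at distance `∈ τ(A)` from a centre `z₂`,
  `τ k ∈ {k, h − k}` injective on `A` ⇒ hit inside `SmallCircuits ℂ (h+h) 4` (`h ≥ 1`). Each stratum
  (sphere of radius `k` about `z₁` against sphere of radius `τ k` about `z₂`) is a TRANSLATE
  (`S ↦ S ∆ (z₁ ∆ z₂)` or `S ↦ S ∆ (z₁ ∆ z₂)ᶜ`), hence automorphic. `z₁ = z₂ = ∅` is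
  `…StrataDoor.partitionMinor_hit_of_weightClasses` (p448961).

WHAT THIS IS NOT: structured classes and a conditional door; nothing on the general middle band,
on TT / item 19616, on crux 14610 or on VP vs VNP.
-/

set_option linter.dupNamespace false

namespace Summit.ValiantsHypothesis.ValiantsHypothesis.Theorems.BarrierLever.StrataDoor

open Finset
open Literature.Barriers.ValiantsHypothesis Literature.Computability.AlgebraicComplexity

variable {h r : ℕ}

/-! ## 1. The leaf-agnostic conditional door -/

/-- **Strata with hit leaves imply item 19717** (`b = c + c' + 3`). -/
theorem partitionMinorsHitByVP_of_strataHit (c c' h₀ : ℕ)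
    (hstrata : ∀ h : ℕ, h₀ ≤ h → ∀ (r : ℕ) (u w : Fin r → Finset (Fin h)),
      Function.Injective u → Function.Injective w →
      ∃ (m : ℕ) (lam mu : Fin h → ℤ) (lr lc : Fin r → ℕ) (π : ℕ → ℕ) (e : Equiv.Perm (Fin r))
        (cr cc : ℕ → ℤ),
        m ≤ (h + h) ^ c ∧ (∀ i, lc (e i) = π (lr i)) ∧
        (∀ i j : Fin r, π (lr i) = π (lr j) → lr i = lr j) ∧ (∀ i, lr i < m) ∧
        Monotone cr ∧ Monotone cc ∧
        (∀ i, cr (lr i) < ∑ a ∈ u i, lam a ∧ ∑ a ∈ u i, lam a ≤ cr (lr i + 1)) ∧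
        (∀ j, cc (lc j) < ∑ c ∈ w j, mu c ∧ ∑ c ∈ w j, mu c ≤ cc (lc j + 1)) ∧
        ∀ t < m, ∃ g ∈ SmallCircuits ℂ (h + h) c', (Matrix.of fun i i' : {i // lr i = t} =>
          MvPolynomial.coeff (∑ a ∈ u i.1, Finsupp.single (Fin.castAdd h a) 1 +
            ∑ c ∈ w (e i'.1), Finsupp.single (Fin.natAdd h c) 1) g).det ≠ 0) :
    Summit.ValiantsHypothesis.ValiantsHypothesis.Theses.BarrierLever.PartitionMinorsHitByVP := by
  classical
  refine ⟨c + c' + 3, max h₀ 1, fun h hh r u w hu hw => ?_⟩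
  have hh1 : 1 ≤ h := (le_max_right _ _).trans hh
  obtain ⟨m, lam, mu, lr, lc, π, e, cr, cc, hm, he, hπ, hlr, hcr, hcc, hrow, hcol, hleaves⟩ :=
    hstrata h ((le_max_left _ _).trans hh) r u w hu hw
  have hex : ∀ t, ∃ g : MvPolynomial (Fin (h + h)) ℂ, t < m →
      (g ∈ SmallCircuits ℂ (h + h) c' ∧ (Matrix.of fun i i' : {i // lr i = t} =>
        MvPolynomial.coeff (∑ a ∈ u i.1, Finsupp.single (Fin.castAdd h a) 1 +
          ∑ c ∈ w (e i'.1), Finsupp.single (Fin.natAdd h c) 1) g).det ≠ 0) := by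
    intro t
    by_cases ht : t < m
    · obtain ⟨g, hg, hd⟩ := hleaves t ht
      exact ⟨g, fun _ => ⟨hg, hd⟩⟩
    · exact ⟨0, fun h' => absurd h' ht⟩
  choose F hF using hex
  obtain ⟨f, hdeg, hsize, hne⟩ := partitionMinor_hit_of_strata_perm m u w lam mu lr lc π e he hπ hlr
    cr cc hcr hcc hrow hcol F (fun t ht => (hF t ht).2)
  refine ⟨f, ⟨?_, ?_⟩, hne⟩
  · exact hdeg.trans (Finset.sup_le fun t ht => (hF t (Finset.mem_range.mp ht)).1.1)
  · refine hsize.trans ?_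
    have h2 : 1 ≤ h + h := by omega
    calc ∑ t ∈ Finset.range m, complexity (F t) + m * (h + h + 2)
        ≤ ∑ _t ∈ Finset.range m, (h + h) ^ (c' + 2) + m * (h + h + 2) := by
          gcongr with t ht
          exact (hF t (Finset.mem_range.mp ht)).1.2.trans (Nat.pow_le_pow_right h2 (by omega))
      _ = m * ((h + h) ^ (c' + 2) + (h + h) + 2) := by
          rw [Finset.sum_const, Finset.card_range, smul_eq_mul]; ring
      _ ≤ (h + h) ^ (c + (c' + 2) + 1) := strata_budget c (c' + 2) m hh1 (by omega) hm
      _ = (h + h) ^ (c + c' + 3) := by ring_nf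

/-! ## 2. Hamming distance to a centre is a threshold functional -/

/-- `Σ_{a ∈ S} (a ∈ z ? −1 : 1) = #(S ∆ z) − #z`. -/
theorem sum_sign_eq_card_symmDiff (S z : Finset (Fin h)) :
    (∑ a ∈ S, (if a ∈ z then (-1 : ℤ) else 1)) = ((symmDiff S z).card : ℤ) - z.card := by
  classical
  rw [← Finset.sum_filter_add_sum_filter_not S (fun a => a ∈ z)]
  rw [Finset.sum_congr rfl (fun a ha => if_pos (Finset.mem_filter.mp ha).2),
    Finset.sum_congr rfl (fun a ha => if_neg (Finset.mem_filter.mp ha).2)]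
  rw [Finset.sum_const, Finset.sum_const, nsmul_eq_mul, nsmul_eq_mul, mul_one,
    Finset.filter_mem_eq_inter, Finset.filter_notMem_eq_sdiff]
  have h1 : ((symmDiff S z).card : ℤ) = (S \ z).card + (z \ S).card := by
    rw [Finset.symmDiff_def, Finset.card_union_of_disjoint disjoint_sdiff_sdiff]
    push_cast
    rfl
  have h2 : (z.card : ℤ) = (z ∩ S).card + (z \ S).card := by
    rw [← Finset.card_inter_add_card_sdiff z S]
    push_cast
    rfl
  rw [h1, h2, Finset.inter_comm z S]
  ring

/-! ## 3. Unions of Hamming spheres around two centres -/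

/-- **Unions of Hamming spheres are hit** (`b = 4`, `h ≥ 1`): rows = ALL sets at distance `∈ A`
from `z₁`, columns = ALL sets at distance `∈ τ(A)` from `z₂`, `τ k ∈ {k, h − k}` injective on `A`. -/
theorem partitionMinor_hit_of_sphereClasses (hh : 1 ≤ h) (u w : Fin r → Finset (Fin h))
    (hu : Function.Injective u) (z₁ z₂ : Finset (Fin h)) (A : Finset ℕ) (τ : ℕ → ℕ)
    (hτ : ∀ k ∈ A, τ k = k ∨ τ k = h - k) (hτinj : ∀ k ∈ A, ∀ k' ∈ A, τ k = τ k' → k = k')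
    (hU : ∀ T : Finset (Fin h), (∃ i, u i = T) ↔ (symmDiff T z₁).card ∈ A)
    (hW : ∀ T : Finset (Fin h), (∃ j, w j = T) ↔ ∃ k ∈ A, (symmDiff T z₂).card = τ k) :
    ∃ f ∈ SmallCircuits ℂ (h + h) 4,
      (Matrix.of fun i j : Fin r => MvPolynomial.coeff
        (∑ a ∈ u i, Finsupp.single (Fin.castAdd h a) 1 +
          ∑ c ∈ w j, Finsupp.single (Fin.natAdd h c) 1) f).det ≠ 0 := by
  classical
  -- distance of a row to the first centre
  set d : Fin r → ℕ := fun i => (symmDiff (u i) z₁).card with hd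
  have hdA : ∀ i, d i ∈ A := fun i => (hU (u i)).mp ⟨i, rfl⟩
  -- the translation carrying sphere `k` about `z₁` onto sphere `τ k` about `z₂`
  set D : Finset (Fin h) := symmDiff z₁ z₂ with hD
  set S : ℕ → Finset (Fin h) := fun t => if τ t = t then D else Dᶜ with hS
  set T : Fin r → Finset (Fin h) := fun i => symmDiff (u i) (S (d i)) with hT
  have hTz : ∀ i, symmDiff (T i) z₂ =
      if τ (d i) = d i then symmDiff (u i) z₁ else (symmDiff (u i) z₁)ᶜ := by
    intro i
    by_cases hc : τ (d i) = d i
    · rw [if_pos hc]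
      simp only [hT, hS, if_pos hc, hD]
      ext a
      simp only [Finset.mem_symmDiff]
      tauto
    · rw [if_neg hc]
      simp only [hT, hS, if_neg hc, hD]
      ext a
      simp only [Finset.mem_symmDiff, Finset.mem_compl]
      tauto
  have hTcard : ∀ i, (symmDiff (T i) z₂).card = τ (d i) := by
    intro i
    rw [hTz i]
    by_cases hc : τ (d i) = d i
    · rw [if_pos hc, hc]
    · rcases hτ _ (hdA i) with h1 | h1
      · exact absurd h1 hc
      · rw [if_neg hc, Finset.card_compl, Fintype.card_fin, h1]
  have hTinj : Function.Injective T := by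
    intro i i' hii
    have hdd : d i = d i' := by
      have := congrArg (fun X => (symmDiff X z₂).card) hii
      simp only [hTcard] at this
      exact hτinj _ (hdA i) _ (hdA i') this
    apply hu
    have : symmDiff (u i) (S (d i)) = symmDiff (u i') (S (d i)) := by
      have := hii
      simp only [hT] at this
      rwa [← hdd] at this
    exact symmDiff_left_injective _ this
  have hTex : ∀ i, ∃ j, w j = T i := fun i => (hW (T i)).mpr ⟨d i, hdA i, hTcard i⟩
  choose e₀ he₀ using hTex
  have he₀inj : Function.Injective e₀ := fun i i' hii =>
    hTinj (by rw [← he₀ i, ← he₀ i', hii])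
  set e : Equiv.Perm (Fin r) := Equiv.ofBijective e₀ (Finite.injective_iff_bijective.mp he₀inj)
    with he
  have he_apply : ∀ i, e i = e₀ i := fun i => rfl
  -- strata = distances, weights `∓1`, cuts `t - 1 - #z`
  have hmono : ∀ z : Finset (Fin h), Monotone (fun t : ℕ => (t : ℤ) - 1 - z.card) :=
    fun z a b hab => by
      show (a : ℤ) - 1 - z.card ≤ (b : ℤ) - 1 - z.card
      omega
  obtain ⟨f, hf, hne⟩ := partitionMinor_hit_of_automorphicStrata (r := r) 1 (h + 1) hh
    (by rw [pow_one]; omega) u w hu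
    (fun a => if a ∈ z₁ then (-1 : ℤ) else 1) (fun a => if a ∈ z₂ then (-1 : ℤ) else 1)
    d (fun j => (symmDiff (w j) z₂).card) τ e
    (fun i => by rw [he_apply, he₀, hTcard])
    (fun i j hij => hτinj _ (hdA i) _ (hdA j) hij)
    (fun i => Nat.lt_succ_of_le ((Finset.card_le_univ _).trans (by simp)))
    (fun t => (t : ℤ) - 1 - z₁.card) (fun t => (t : ℤ) - 1 - z₂.card) (hmono z₁) (hmono z₂)
    (fun i => by rw [sum_sign_eq_card_symmDiff]; push_cast; simp only [hd]; constructor <;> linarith)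
    (fun j => by rw [sum_sign_eq_card_symmDiff]; push_cast; constructor <;> linarith)
    (fun _ => Equiv.refl _) S
    (fun i => by rw [he_apply, he₀, Equiv.coe_refl, Finset.image_id])
  exact ⟨f, by simpa using hf, hne⟩

end Summit.ValiantsHypothesis.ValiantsHypothesis.Theorems.BarrierLever.StrataDoor
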